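import Summits.CriticalPhenomena.PercolationContinuityZ3.Theorems.PercNearOneGluingNoHeavyLowerTailIncStarDegreeTwoRoot
import HarnessLib

/-!
# The joint (star, hRZ) induction: the base case of an otherwise isolated root

Support file for the Sahi programme (`--supports stmt-CriticalPhenomena-4575`, prover prim-sahi-p2 gen 29).  No definitions, no named facts, no
sorries; standard axioms.  Memo `run/shared/lean/prim/prim-sahi/FROM-prim-sahi-p2-gen29-ROOT-FIBRE-DICHOTOMY.md` §4c, `prim-sahi-p2/PROOF-E3.md` (39j).

In the joint induction on (increasing star, root-edge Bernstein forms hRZ) of memo §4c the hRZ step along a root pair `e = s(s,z)` expands along a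
SECOND fractional root pair (`EdgeInduction.rootEdgeBernstein_of_twoEdgeFibres`).  When there is none and every other pair at the root has weight `0`,
the root is almost surely isolated once `e` is pinned closed, and both hRZ forms along `e` are nonnegative outright: the one with two closed copies is
`(2/3)·P_{w[e↦1]}(A∩B∩C)`, the one with two glued copies is a pendant-root form, nonnegative by Harris' inequality
(`IncStar.polar₁_pin00_left_nonneg`, `IncStar.polar₁_pin00_right_nonneg` with `u = v = z`).  **`rootEdgeBernstein_of_isolatedRoot`.**
-/

noncomputable section

namespace Summit.CriticalPhenomena.PercolationContinuityZ3.Theorems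

namespace IncStar

open MeasureTheory Set Literature.Probability.Percolation Literature.Probability.LatticeModels EdgeInduction
open scoped Classical

variable {n : ℕ}

/-- **Base case of the hRZ induction: an otherwise isolated root.**  If every pair `s(s,z')`, `z' ∉ {s, z}`, has weight `0`, then both root-edge
Bernstein forms of the increasing star along `e = s(s,z)` are nonnegative (targets `b, c, y ≠ s`). [this work] -/
theorem rootEdgeBernstein_of_isolatedRoot (w : Sym2 (Fin n) → unitInterval) {s z b c y : Fin n}
    (hb : b ≠ s) (hc : c ≠ s) (hy : y ≠ s)
    (hw : ∀ z' : Fin n, z' ≠ s → z' ≠ z → w s(s, z') = 0) :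
    0 ≤ polar₁ (prodBernoulli (Function.update w s(s, z) 0)) (prodBernoulli (Function.update w s(s, z) 1))
        (openConn s b) (openConn s c) (openConn s y) ∧
      0 ≤ polar₁ (prodBernoulli (Function.update w s(s, z) 1)) (prodBernoulli (Function.update w s(s, z) 0))
        (openConn s b) (openConn s c) (openConn s y) := by
  have hw' : ∀ z' : Fin n, z' ≠ s → z' ≠ z → z' ≠ z → w s(s, z') = 0 := fun z' h1 h2 _ => hw z' h1 h2
  have hpin : pin₂ w s(s, z) s(s, z) 0 0 = prodBernoulli (Function.update w s(s, z) 0) := by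
    simp only [pin₂, Function.update_idem]
  constructor
  · have h := polar₁_pin00_left_nonneg w hw' hb hc hy (prodBernoulli (Function.update w s(s, z) 1))
    rwa [hpin] at h
  · have h := polar₁_pin00_right_nonneg w (Function.update w s(s, z) 1) hw' hb hc hy
    rwa [hpin] at h

end IncStar

end Summit.CriticalPhenomena.PercolationContinuityZ3.Theorems

end
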